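import Summits.ValiantsHypothesis.ValiantsHypothesis.Theorems.LacunarySymmetroidMatrixDescartesCensusReflectChunks
import Summits.ValiantsHypothesis.ValiantsHypothesis.Theorems.LacunarySymmetroidMatrixDescartesCensusReflectGauss

/-!
# `MatrixDescartes` census — reflective certificates, Part 2G: CHUNKABLE rows with the GAUSSIAN sign

HONEST FRAMING.  Verification infrastructure for the finite census of real symmetric lacunary pencils (cells
`pub-symmetroid`, `val-V1-extremal`); it only COMBINES two landed kits: Part 2 (`…CensusReflectChunks`: list-based chunks
`chunkCheck`, localised root count `le_card_Ioo_of_chunkCheck`, gluing, `not_posRootLawAt_of_le_card_Ioo`) and the Gaussian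
sign (`…CensusReflectGauss`: `signAtG`, `signAtG_eq : signAtG = signAt`).  Nothing here bears on the asymptotic crux
`Theses.LacunarySymmetroid.MatrixDescartes` (stmt-ValiantsHypothesis-18050) nor on `VP ≠ VNP`.

WHY.  A row with `m ≥ 7` and many test points needs BOTH devices: the Laplace sign of Part 1/2 costs `m!` products per point
(infeasible at `m = 9`), and a single-file Gaussian certificate `certCheckG` can exceed one gate node's elaboration budget
(observed: the `(9,5)` gap-flag row of val-V1-extremal, 113 points of 9×9 eliminations on ≈ 6 400-digit letters, > 600 s).
Here `chunkCheckG` = `chunkCheck` with `signAtG` in place of `signAt`; `chunkCheckG_eq` transports every Part-2 theorem, so a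
big row = several files `chunkCheckG … = true` (`decide +kernel` each) + one small assembling file, exactly as in Part 2.

[folklore] Elementary (the two kits' soundness theorems); proof by reflection.
-/

-- `Summit.ValiantsHypothesis.ValiantsHypothesis.…` repeats a component by the D-0017 layout
-- (single-conjunct summit), which the `dupNamespace` linter flags; the name is mandated.
set_option linter.dupNamespace false

namespace Summit.ValiantsHypothesis.ValiantsHypothesis.Theorems.LacunarySymmetroidMatrixDescartes.Census.Reflect

open Summit.ValiantsHypothesis.ValiantsHypothesis.Theorems.MatrixDescartes.Negative (PosRootLawAt)

/-- Exact signs at a list of rational points, computed by the fraction-free Gaussian `signAtG`. [folklore] -/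
def signsLG (m K D : ℕ) (d : Fin K → ℕ) (S : Fin K → Fin m → Fin m → ℤ) : List (ℕ × ℕ) → List ℤ
  | [] => []
  | p :: ps => signAtG m K D d S p.1 p.2 :: signsLG m K D d S ps

/-- **Chunk check, Gaussian sign**: the points `lo :: mid ++ [hi]` are positive, strictly increasing, and the exact determinant
signs (by `gsign`) alternate. [folklore] -/
def chunkCheckG (m K : ℕ) (d : Fin K → ℕ) (S : Fin K → Fin m → Fin m → ℤ) (lo : ℕ × ℕ) (mid : List (ℕ × ℕ))
    (hi : ℕ × ℕ) : Bool :=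
  monoL (lo :: (mid ++ [hi])) && altL (signsLG m K (finMax K d) d S (lo :: (mid ++ [hi])))

/-- `signsLG = signsL` (pointwise `signAtG_eq`). [folklore] -/
theorem signsLG_eq (m K D : ℕ) (d : Fin K → ℕ) (S : Fin K → Fin m → Fin m → ℤ) :
    ∀ ps : List (ℕ × ℕ), signsLG m K D d S ps = signsL m K D d S ps
  | [] => rfl
  | p :: ps => by rw [signsLG, signsL, signAtG_eq, signsLG_eq m K D d S ps]

/-- `chunkCheckG = chunkCheck`. [folklore] -/
theorem chunkCheckG_eq (m K : ℕ) (d : Fin K → ℕ) (S : Fin K → Fin m → Fin m → ℤ) (lo : ℕ × ℕ)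
    (mid : List (ℕ × ℕ)) (hi : ℕ × ℕ) : chunkCheckG m K d S lo mid hi = chunkCheck m K d S lo mid hi := by
  unfold chunkCheckG chunkCheck
  rw [signsLG_eq]

/-- **Chunk (Gaussian) ⇒ localised root count**: `mid.length + 1` distinct roots in `(lo, hi)`. [folklore] -/
theorem le_card_Ioo_of_chunkCheckG {m K : ℕ} {d : Fin K → ℕ} {S : Fin K → Fin m → Fin m → ℤ}
    {lo : ℕ × ℕ} {mid : List (ℕ × ℕ)} {hi : ℕ × ℕ} (h : chunkCheckG m K d S lo mid hi = true) :
    mid.length + 1 ≤ ((pencilPolyZ m K d S).roots.toFinset.filter (fun t => ptR lo < t ∧ t < ptR hi)).card :=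
  le_card_Ioo_of_chunkCheck (by rwa [chunkCheckG_eq] at h)

/-- a certified Gaussian chunk's ends are ordered. [folklore] -/
theorem ptR_lt_of_chunkCheckG {m K : ℕ} {d : Fin K → ℕ} {S : Fin K → Fin m → Fin m → ℤ}
    {lo : ℕ × ℕ} {mid : List (ℕ × ℕ)} {hi : ℕ × ℕ} (h : chunkCheckG m K d S lo mid hi = true) :
    ptR lo < ptR hi :=
  ptR_lt_of_chunkCheck (by rwa [chunkCheckG_eq] at h)

/-- a certified Gaussian chunk starts at a positive point. [folklore] -/
theorem ptR_pos_of_chunkCheckG {m K : ℕ} {d : Fin K → ℕ} {S : Fin K → Fin m → Fin m → ℤ}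
    {lo : ℕ × ℕ} {mid : List (ℕ × ℕ)} {hi : ℕ × ℕ} (h : chunkCheckG m K d S lo mid hi = true) :
    0 < ptR lo :=
  ptR_pos_of_chunkCheck (by rwa [chunkCheckG_eq] at h)

/-- One-chunk convenience form (Gaussian). [folklore] -/
theorem not_posRootLawAt_of_chunkCheckG {m K B : ℕ} {d : Fin K → ℕ} {S : Fin K → Fin m → Fin m → ℤ}
    {lo : ℕ × ℕ} {mid : List (ℕ × ℕ)} {hi : ℕ × ℕ} (hS : symmB m K S = true)
    (h : chunkCheckG m K d S lo mid hi = true) (hB : B < mid.length + 1) : ¬ PosRootLawAt m K B :=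
  not_posRootLawAt_of_chunkCheck hS (by rwa [chunkCheckG_eq] at h) hB

/-- **Running-union step** used by assembling files: if `N` roots lie in `(p₀, p)` with `p₀ < p` and a further Gaussian chunk
certifies `mid.length + 1` roots in `(p, q)`, then `N + (mid.length + 1)` roots lie in `(p₀, q)` and `p₀ < q`. [folklore] -/
theorem glue_chunkCheckG {m K N : ℕ} {d : Fin K → ℕ} {S : Fin K → Fin m → Fin m → ℤ}
    {p₀ p q : ℕ × ℕ} {mid : List (ℕ × ℕ)} (hlt : ptR p₀ < ptR p)
    (hN : N ≤ ((pencilPolyZ m K d S).roots.toFinset.filter (fun t => ptR p₀ < t ∧ t < ptR p)).card)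
    (h : chunkCheckG m K d S p mid q = true) :
    ptR p₀ < ptR q ∧
      N + (mid.length + 1) ≤ ((pencilPolyZ m K d S).roots.toFinset.filter (fun t => ptR p₀ < t ∧ t < ptR q)).card :=
  ⟨hlt.trans (ptR_lt_of_chunkCheckG h),
    (Nat.add_le_add hN (le_card_Ioo_of_chunkCheckG h)).trans
      (card_filter_Ioo_add_le _ hlt.le (ptR_lt_of_chunkCheckG h).le)⟩

/-! ### Smoke test: the kit's toy row in two Gaussian chunks. -/

/-- `ζ(2,2) ≥ 2` for the toy pencil `diag(−1,−2) + t·1`: chunk `(1/2,[],3/2)` and chunk `(3/2,[],4)` glued (an `example`; the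
statement is the kit's `toy_not_posRootLawAt_2_2_1`). [folklore] -/
example : ¬ PosRootLawAt 2 2 1 := by
  have h₁ : chunkCheckG 2 2 ![0, 1] ![![![-1, 0], ![0, -2]], ![![1, 0], ![0, 1]]] (1, 2) [] (3, 2) = true := by
    decide +kernel
  have h₂ : chunkCheckG 2 2 ![0, 1] ![![![-1, 0], ![0, -2]], ![![1, 0], ![0, 1]]] (3, 2) [] (4, 1) = true := by
    decide +kernel
  have g := glue_chunkCheckG (ptR_lt_of_chunkCheckG h₁) (le_card_Ioo_of_chunkCheckG h₁) h₂
  exact not_posRootLawAt_of_le_card_Ioo (by decide +kernel) (ptR_pos_of_chunkCheckG h₁).le g.2 (by norm_num)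

end Summit.ValiantsHypothesis.ValiantsHypothesis.Theorems.LacunarySymmetroidMatrixDescartes.Census.Reflect
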